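import Summits.AtomisticToContinuum.HydrodynamicLimit.Theorems.TransferActivityTails.Negative.EquilibriumReduction
import HarnessLib

/-!
# Pathwise hot/cold split of the window energy activity (stub `stub_pathwiseSplit`)

Crux `Summit.AtomisticToContinuum.HydrodynamicLimit.Theses.OneFlightGossipEngine.EnergyActivityTails`
(stmt-AtomisticToContinuum-17703), line `Sketch` (card `coboundary-hot-cold-split`), registered stub
`stub_pathwiseSplit : RecordGain → Coboundary → PathwiseSplit` (the line vocabulary `Cfg`, `gainOf`, `hotSupplyOf`,
`RecordGain`, `Coboundary`, `PathwiseSplit` is re-declared verbatim from the line skeleton; Theorems files cannot import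
the crux workfile).

## Content

K3 of the line is pure bookkeeping GIVEN K1 (record gain bound at contact) and K2 (coboundary).  Along a good orbit
of the hard-sphere flow `Φ` on `𝕋³` the collision times in a bounded window `(a, b]` are finitely many
(`HardSphereFlow.finite_collisionTimes_inter`), so every window collision sum is an honest finite sum over the pairs
`(t, p)` with `p` an ordered contact pair of `Φ.flow t z` (`collisionSum_eq_collisionPairSum`,
`collisionPairSum_add/const_mul/mono`), and every record in the sum is read off a CONTACT configuration
(`mem_contactPairs`), where K1 applies.  Record by record, with `g` the signed gain of `i`, `e = |g|` its energy
impulse, `m = ‖Δv_i‖` its momentum impulse and `h` the hot supply at cap `M ≥ 0`: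
`|g| = 2 g⁺ − g`; on a collision with a COLD-normal partner (`|⟪v_snd⁻, ω⟫| ≤ M`) K1 gives
`g⁺ ≤ ‖Δv_i‖ · |⟪v_snd⁻, ω⟫| ≤ M · m` and `h = 0`; on a HOT one `g⁺ = h`; in both cases `e + g ≤ 2 M m + 2 h`
(`energyOf_add_gainOf_le`).  Summing and inserting K2, `Σ g = (‖v_i(b)‖² − ‖v_i(a)‖²)/2 ≥ −‖v_i(a)‖²/2`, gives
`Σ e ≤ ‖v_i(a)‖²/2 + 2 M Σ m + 2 Σ h` (`stub_pathwiseSplit`).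

References (for the vocabulary only; the content is elementary): I. Gallagher, L. Saint-Raymond, B. Texier, *From Newton
to Boltzmann* (2013) §4.1 (collision records of the hard-sphere flow, elastic law).
-/

noncomputable section

open MeasureTheory Set
open scoped InnerProductSpace

namespace Summit.AtomisticToContinuum.HydrodynamicLimit.Theorems.EnergyActivityTailsPathwiseSplit

open Literature.MathematicalPhysics.KineticTheory Literature.Analysis.FluidPDE
open Summit.AtomisticToContinuum.HydrodynamicLimit.Theorems.TransferActivityTailsNegative
  (Flow Rec energyOf momentumOf)

/-! ## §0 Vocabulary (verbatim from the line skeleton) -/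

/-- Configurations of `N + 1` spheres on `𝕋³` (registered stub vocabulary of line Sketch, crux EnergyActivityTails
(stmt-AtomisticToContinuum-17703) — route-internal, not a cited fact). -/
abbrev Cfg (N : ℕ) : Type := Config (N + 1) (Fin 3) T3

/-- Signed kinetic-energy change of `fst` in the record `c` (the GAIN of `i`; `energyOf = |gainOf|`) (registered stub
vocabulary of line Sketch, crux EnergyActivityTails (stmt-AtomisticToContinuum-17703) — route-internal, not a cited fact). -/
def gainOf (N : ℕ) (i : Fin (N + 1)) (c : Rec N) : ℝ :=
  if c.fst = i then (‖c.postVel.1‖ ^ 2 - ‖c.preVel.1‖ ^ 2) / 2 else 0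

/-- **Hot supply at cap `M`**: the energy RECEIVED by `i` (positive part of its gain) in a collision whose partner arrives
with normal speed `|⟪v_snd⁻, ω⟫| > M` (`ω = c.impactVec`, a unit vector at contact); zero on every collision with a
cold-normal partner (registered stub vocabulary of line Sketch, crux EnergyActivityTails (stmt-AtomisticToContinuum-17703) —
route-internal, not a cited fact). -/
def hotSupplyOf (M : ℝ) (N : ℕ) (i : Fin (N + 1)) (c : Rec N) : ℝ :=
  if c.fst = i ∧ M < |⟪c.preVel.2, c.impactVec⟫_ℝ| then max ((‖c.postVel.1‖ ^ 2 - ‖c.preVel.1‖ ^ 2) / 2) 0 else 0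

/-- **K1 — RECORD GAIN BOUND (record kinematics at contact).** For a record read off a contact configuration of `N + 1`
spheres of diameter `hsDiameter σ N > 0`: the positive part of the first partner's energy gain is at most its momentum
impulse times the partner's incoming normal speed, `g⁺ ≤ ‖v_fst⁺ − v_fst⁻‖ · |⟪v_snd⁻, ω⟫|` (the elastic law swaps the normal
components) (registered stub signature of line Sketch, crux EnergyActivityTails (stmt-AtomisticToContinuum-17703) —
route-internal, not a cited fact; a HYPOTHESIS here, proved by the line's stub `stub_recordGain`). -/
def RecordGain : Prop :=
  ∀ (σ : ℝ), 0 < σ → ∀ (N : ℕ) (z : Cfg N) (t : ℝ) (i j : Fin (N + 1)),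
    z ∈ contactSet (Torus.geometry (Fin 3)) (N + 1) (hsDiameter σ N) i j →
    max ((‖(HardSphereCollisionRecord.ofConfig (Torus.geometry (Fin 3)) (hsDiameter σ N) z t i j).postVel.1‖ ^ 2 -
          ‖(HardSphereCollisionRecord.ofConfig (Torus.geometry (Fin 3)) (hsDiameter σ N) z t i j).preVel.1‖ ^ 2) / 2) 0 ≤
      ‖(HardSphereCollisionRecord.ofConfig (Torus.geometry (Fin 3)) (hsDiameter σ N) z t i j).postVel.1 -
          (HardSphereCollisionRecord.ofConfig (Torus.geometry (Fin 3)) (hsDiameter σ N) z t i j).preVel.1‖ *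
        |⟪(HardSphereCollisionRecord.ofConfig (Torus.geometry (Fin 3)) (hsDiameter σ N) z t i j).preVel.2,
          (HardSphereCollisionRecord.ofConfig (Torus.geometry (Fin 3)) (hsDiameter σ N) z t i j).impactVec⟫_ℝ|

/-- **K2 — COBOUNDARY (telescoping of the signed gains).** Along a good orbit of a hard-sphere flow on `𝕋³`
(`0 < σ < 1/2`) the window sum over `(a, b]` of `i`'s signed energy gains is the change of `i`'s kinetic energy across the
window (registered stub signature of line Sketch, crux EnergyActivityTails (stmt-AtomisticToContinuum-17703) — route-internal,
not a cited fact; a HYPOTHESIS here, proved by the line's stub `stub_coboundary`). -/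
def Coboundary : Prop :=
  ∀ (σ : ℝ), 0 < σ → σ < 1 / 2 → ∀ (N : ℕ) (Φ : Flow σ N) (z : Cfg N), z ∈ Φ.good →
    ∀ (a b : ℝ), a ≤ b → ∀ i : Fin (N + 1),
      Φ.collisionSum (Set.Ioc a b) (gainOf N i) z = (‖(Φ.flow b z i).2‖ ^ 2 - ‖(Φ.flow a z i).2‖ ^ 2) / 2

/-- **K3 — PATHWISE SPLIT at a cap `M ≥ 0`.** For every good orbit, window `(a, b]` and particle:
`Σ|ΔE_i| ≤ ‖v_i(a)‖²/2 + 2M·Σ‖Δv_i‖ + 2·Σ hotSupply_M` (`|g| = 2g⁺ − g`, K2 for `Σ g`, K1 on the cold-normal collisions)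
(registered stub signature of line Sketch, crux EnergyActivityTails (stmt-AtomisticToContinuum-17703) — route-internal, not a
cited fact; the CONCLUSION of `stub_pathwiseSplit`). -/
def PathwiseSplit : Prop :=
  ∀ (M : ℝ), 0 ≤ M → ∀ (σ : ℝ), 0 < σ → σ < 1 / 2 → ∀ (N : ℕ) (Φ : Flow σ N) (z : Cfg N), z ∈ Φ.good →
    ∀ (a b : ℝ), a ≤ b → ∀ i : Fin (N + 1),
      Φ.collisionSum (Set.Ioc a b) (energyOf N i) z ≤
        ‖(Φ.flow a z i).2‖ ^ 2 / 2 + 2 * M * Φ.collisionSum (Set.Ioc a b) (momentumOf N i) z +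
          2 * Φ.collisionSum (Set.Ioc a b) (hotSupplyOf M N i) z

/-! ## §1 Record-by-record bookkeeping -/

/-- **The record-by-record inequality behind K3.** If the record `c` satisfies the K1 bound
`g⁺ ≤ ‖v_fst⁺ − v_fst⁻‖ · |⟪v_snd⁻, ω⟫|` and `0 ≤ M`, then for every particle `i`:
`energyOf + gainOf ≤ 2 M · momentumOf + 2 · hotSupplyOf M` (all four vanish unless `c.fst = i`; if the partner is
cold-normal, `|⟪v_snd⁻, ω⟫| ≤ M`, then `|g| + g = 2 g⁺ ≤ 2 M ‖Δv‖` and the hot supply is `0`; if it is hot then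
`|g| + g = 2 g⁺ = 2 · hotSupply` and `2 M ‖Δv‖ ≥ 0`). -/
theorem energyOf_add_gainOf_le {M : ℝ} (hM : 0 ≤ M) {N : ℕ} (i : Fin (N + 1)) (c : Rec N)
    (hc : max ((‖c.postVel.1‖ ^ 2 - ‖c.preVel.1‖ ^ 2) / 2) 0 ≤
      ‖c.postVel.1 - c.preVel.1‖ * |⟪c.preVel.2, c.impactVec⟫_ℝ|) :
    energyOf N i c + gainOf N i c ≤ 2 * M * momentumOf N i c + 2 * hotSupplyOf M N i c := by
  unfold energyOf gainOf momentumOf hotSupplyOf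
  by_cases hi : c.fst = i
  · -- `|g| = 2 g⁺ − g` for the signed gain `g`
    have habs : |‖c.postVel.1‖ ^ 2 - ‖c.preVel.1‖ ^ 2| / 2 =
        2 * max ((‖c.postVel.1‖ ^ 2 - ‖c.preVel.1‖ ^ 2) / 2) 0 - (‖c.postVel.1‖ ^ 2 - ‖c.preVel.1‖ ^ 2) / 2 := by
      rcases le_total 0 (‖c.postVel.1‖ ^ 2 - ‖c.preVel.1‖ ^ 2) with h | h
      · rw [abs_of_nonneg h, max_eq_left (div_nonneg h zero_le_two)]
        ring
      · rw [abs_of_nonpos h, max_eq_right (div_nonpos_of_nonpos_of_nonneg h zero_le_two)]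
        ring
    rw [if_pos hi, if_pos hi, if_pos hi, habs]
    have hm : 0 ≤ M * ‖c.postVel.1 - c.preVel.1‖ := mul_nonneg hM (norm_nonneg _)
    by_cases hhot : M < |⟪c.preVel.2, c.impactVec⟫_ℝ|
    · rw [if_pos ⟨hi, hhot⟩]
      linarith
    · rw [if_neg fun h => hhot h.2]
      have hcold : max ((‖c.postVel.1‖ ^ 2 - ‖c.preVel.1‖ ^ 2) / 2) 0 ≤ ‖c.postVel.1 - c.preVel.1‖ * M :=
        hc.trans (mul_le_mul_of_nonneg_left (not_lt.1 hhot) (norm_nonneg _))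
      linarith
  · rw [if_neg hi, if_neg hi, if_neg hi, if_neg fun h => hi h.1]
    linarith

/-! ## §2 The stub -/

/-- **Stub K3 (registered): the pathwise split** `Σ|ΔE_i| ≤ ‖v_i(a)‖²/2 + 2M·Σ‖Δv_i‖ + 2·Σ hotSupply_M` on every good
orbit, window `(a, b]` and particle, from K1 (`RecordGain`) and K2 (`Coboundary`): the window carries finitely many
collision times (`HardSphereFlow.finite_collisionTimes_inter`), every record in the window sum is read off a contact
configuration (`mem_contactPairs`) so K1 feeds `energyOf_add_gainOf_le` record by record, the finite collision pair sums
are additive, homogeneous and monotone (`collisionPairSum_add/const_mul/mono`), and K2 evaluates `Σ gainOf` as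
`(‖v_i(b)‖² − ‖v_i(a)‖²)/2 ≥ −‖v_i(a)‖²/2`. -/
theorem stub_pathwiseSplit : RecordGain → Coboundary → PathwiseSplit := by
  intro hK1 hK2 M hM σ hσ hσ2 N Φ z hz a b hab i
  have hfin := Φ.finite_collisionTimes_inter hz (S := Set.Ioc a b) Set.Ioc_subset_Icc_self
  -- the record-by-record inequality, summed over the (finitely many) collisions of the window
  have hsum : Φ.collisionSum (Set.Ioc a b) (energyOf N i) z + Φ.collisionSum (Set.Ioc a b) (gainOf N i) z ≤
      2 * M * Φ.collisionSum (Set.Ioc a b) (momentumOf N i) z +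
        2 * Φ.collisionSum (Set.Ioc a b) (hotSupplyOf M N i) z := by
    simp only [HardSphereFlow.collisionSum_eq, collisionSum_eq_collisionPairSum]
    rw [← collisionPairSum_const_mul hfin, ← collisionPairSum_const_mul hfin, ← collisionPairSum_add hfin,
      ← collisionPairSum_add hfin]
    exact collisionPairSum_mono hfin fun t _ p hp =>
      energyOf_add_gainOf_le hM i _ (hK1 σ hσ N (Φ.flow t z) t p.1 p.2 (mem_contactPairs.1 hp).2)
  -- K2 evaluates the signed-gain sum; the endpoint energy at `b` is nonnegative
  rw [hK2 σ hσ hσ2 N Φ z hz a b hab i] at hsum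
  have hb : 0 ≤ ‖(Φ.flow b z i).2‖ ^ 2 := by positivity
  linarith

end Summit.AtomisticToContinuum.HydrodynamicLimit.Theorems.EnergyActivityTailsPathwiseSplit

end
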